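import Summits.BirchSwinnertonDyer.BirchSwinnertonDyer.Theorems.SignedLowerHalvesSmallImageMuZeroOneSignMuControl
import Summits.BirchSwinnertonDyer.BirchSwinnertonDyer.Theorems.SignedLowerHalvesKobayashiLowerHalfLargeImageSignDefectX7
import Summits.BirchSwinnertonDyer.BirchSwinnertonDyer.Theorems.SignedLowerHalvesKobayashiLowerHalfLargeImageHorocycleMuDoor
import Summits.BirchSwinnertonDyer.Rank1Residual.Supersingular.KobayashiSqueezeReal
import Summits.BirchSwinnertonDyer.Rank1Residual.X2.AnalyticInvariants
import HarnessLib

/-!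
# Route `SignedLowerHalves`, crux L `SmallImageLowerHalfBothSigns` (item stmt-BirchSwinnertonDyer-23599), line
# `birth_acns` v15, stub `stub_lambdaLowerThree_ns`: the `p = 3` λ-stub is the `p = 3` TWIN of route
# `ResidualThetaTransportAtTwo` — part 1 (Core): the ASSEMBLY, ported to odd `p` (cell `bsd-ssimc`, width seat
# `bsd-line-slh-p3-w3` gen 8; ROUTE-INDEPENDENT helper, `--supports stmt-BirchSwinnertonDyer-23599 --as helper`;
# THEOREMS ONLY — no definition, no named fact, no `sorry`; closes nothing; BSD is not proved by any of this)

HONEST FRAMING. The registered stub `stub_lambdaLowerThree_ns` (= retired item 23118 `SmallImageLambdaLowerAtThree`,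
verbatim) asks, at EVERY small-image supersingular X7 pair with `p = 3` (`ρ̄_{E,3}(Γ_ℚ) = N(C_ns(3))`, i.e.
`ρ̄ ≅ Ind_K χ̄` with `K` imaginary quadratic and `3` INERT in `K` — kernel: k3-c4 `…SmallImageShadowInert`), for the
`p`-inverted Eisenstein half of Kobayashi's signed main conjecture at every sign. Gens 0–7 of this seat graded it
«class-wide open mathematics». This file and its sequel (`…LambdaLowerThreeNsThetaTransport.lean`) show that it is,
on the WHOLE class, the `p = 3` twin of the READY, tribunal-passed route
`route-BirchSwinnertonDyer-ResidualThetaTransportAtTwo` («Kobayashi's `+` main conjecture at `2` … by RESIDUAL THETA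
TRANSPORT from a CM NEWFORM `g = θ_ψ`; the partner enters ONLY through its Mazur–Tate elements; the partner's own
algebraic side is eliminated: `Sel^±(ℚ_∞, W[p]) = Sel^±(ℚ_∞, ρ̄_g)` is ONE object»), every research item of which
carries the planner's note «printed for `p` odd», and whose `μ`-item is at `p = 3` ALREADY PROVED modulo print on
our class (THEOREM B + lane B, child M 23600 (B1)). Here: the assembly.

* §1 `exists_generator_of_lamTransport` — the Λ-algebra of that route's deciding theorem (`closes`, block `hMC`)
  at GENERAL `p`: `C(pⁿ)·L = g₁·h` (Kato up to `pⁿ`), `μ(g₁) = 0`, `L` of unit content, `λ(g₁) = λ(L)` ⟹ for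
  every unit `u ∈ ℤ_p` a generator `g` of `(g₁)` with `ι g = C(u)·ι L` (with the general-`p` ports
  `exists_unit_of_mu_of_lam`, `mu_lam_C_pow_mul_of_hasUnitContent` of `SignedTransportAtTwo.exists_unit_of_mu_of_lam`).
* §2 `kobayashiMainConjecture_of_lamTransport` — ODD `p`, good supersingular `a_p = 0`, `ρ̄_{E,p}` NOT onto; print
  by name (`hCK`, `h12`, `h41` RATIONAL clause, `h5`/`h3`); the one-sign ANALYTIC floor `hfloor` (`μ(L^ε_p(E)) = 0`);
  and the **λ-TRANSPORT** `hlamT` («for every sign-`ε` dual datum with `μ = 0` and every `G` with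
  `ι G = C(p^m ϖ)·ι L^ε`: `λ(X^ε) = λ(G)`» — the NET of that route's items Kan⁺ `ThetaLayerLambdaCongruenceAtTwo`
  and Kλ⁺ `ResidualThetaMainConjectureAtTwo` at a common layer, read at `p`; the sequel derives it from their
  verbatim `p`-twins) ⟹ `KobayashiMainConjecture W p ε`. The algebraic `μ = 0` is NOT a hypothesis: it is lane
  B's brick `SmallImageMuControl.mu_eq_zero_of_isSignedPAdicLFunction_of_hasUnitContent` fed by the floor. At
  `p ≥ 5` the floor is the 23117-type one-sign rider, so this is a second, ENGINE-FREE architecture for crux 4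
  `KobayashiMainConjectureSmallImage` at every odd `p`: print ∧ one-sign `μ`-floor ∧ λ-transport.
* §3 `p = 3`: the floor is the tree's INPUT-FREE THEOREM B (`LargeImageMuFloor.signedMuFloor_three`), so
  `exists_kobayashiMainConjecture_three_of_lamTransport` needs ONLY print + the λ-transport (at every sign; the one
  at THEOREM B's sign is used); with the JOINT package `hJ` the sign is idle on X7
  (`SignDefect.X7.exists_kobayashiLowerDivisibility_iff_forall`): `forall_kobayashiLowerDivisibility_three_of_lamTransport`
  = crux L's signature body at the pair; `lambdaShape_three_of_lamTransport` = the registered stub text (`m = 0`).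

What is NOT here: the three `p = 3` residual-theta-transport statements themselves (partner existence K0@3, the
analytic layer congruence Kan@3 = Vatsal 1999 (tree fact `vatsal1999_plusSymbol_congruence`) + Pollack 2003, and
the residual λ-formula / residual theta count Kλ@3 = Greenberg–Vatsal (10) + B. D. Kim 2009 + Hatley–Lei 2019
Thm. 4.6 + the λ-part of the signed main conjecture for the CM form `g` at the inert `3`) — displayed in the sequel,
print-composite at odd `p`, NOT typed; the verdict `stub-blocked` stands as a kernel matter. Memo: crux dir
`Lines/birth_acns-MEMO-w3-g8.md`.

References: [Kobayashi2003] Thm. 1.2 (p. 2), Thm. 4.1 (p. 8), Thm. 5.2 iv), Thm. 7.4 (p. 13), Conjecture (p. 2);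
[PollackWeston2011MT] §2.1–2.2, §3.1, Thm. 4.1 (1), Rem. 4.2; [GreenbergVatsal2000] p. 4, §1 (8)–(10), §3 Rem. 3.4;
[Vatsal1999] §1 (1.6), Thm. (1.13); [HatleyLei2019] Thm. 4.6; [BDKim2009] Cor. 2.13; [Vaserstein1972SL2] Theorem;
[Washington1997] §7.1, §13.2.
-/

set_option autoImplicit false
-- D-0017: single-problem summit, the namespace repeats the problem name by design.
set_option linter.dupNamespace false
noncomputable section

open scoped Classical MatrixGroups ModularForm

open CongruenceSubgroup WeierstrassCurve Field
  Literature.NumberTheory.EllipticCurves Literature.NumberTheory.EllipticCurves.ModularForms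
  Literature.NumberTheory.EllipticCurves.Rank1Residual
  Literature.NumberTheory.EllipticCurves.Kobayashi2003
  Literature.NumberTheory.EllipticCurves.GreenbergVatsal2000 ZpExtension
  Summit.BirchSwinnertonDyer.Rank1Residual.Supersingular
  Summit.BirchSwinnertonDyer.Rank1Residual.X1.MuLambda

namespace Summit.BirchSwinnertonDyer.BirchSwinnertonDyer.Theorems.SmallImageLambdaLowerThreeNsThetaTransport

section Algebra

variable {p : ℕ} [Fact p.Prime]

/-- Unit content means `red L ≠ 0` (`p ∤ L`). [folklore] -/
theorem red_ne_zero_of_hasUnitContent {L : IwasawaAlgebra p} (hL : HasUnitContent L) : red L ≠ 0 := by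
  rw [Ne, red_eq_zero_iff]
  exact (hasUnitContent_iff_not_C_dvd L).mp hL

/-- `μ(C(pⁿ)·L) = n` and `λ(C(pⁿ)·L) = λ(L)` for `L` of unit content. [folklore] -/
theorem mu_lam_C_pow_mul_of_hasUnitContent {L : IwasawaAlgebra p} (hL : HasUnitContent L) (n : ℕ) :
    mu (PowerSeries.C ((p : ℤ_[p]) ^ n) * L) = n ∧ lam (PowerSeries.C ((p : ℤ_[p]) ^ n) * L) = lam L := by
  have hred := red_ne_zero_of_hasUnitContent hL
  obtain ⟨hμ, hpf⟩ := mu_eq_and_pfree_eq (g := PowerSeries.C ((p : ℤ_[p]) ^ n) * L) hred rfl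
  obtain ⟨-, hpfL⟩ := mu_eq_and_pfree_eq (g := L) (a := 0) hred (by rw [pow_zero, map_one, one_mul])
  refine ⟨hμ, ?_⟩
  simp only [lam, hpf, hpfL]

/-- An element `h ≠ 0` of `Λ` with `μ(h) = n` and `λ(h) = 0` is `C(pⁿ)` times a unit. [folklore] -/
theorem exists_unit_of_mu_of_lam {h : IwasawaAlgebra p} (hh : h ≠ 0) {n : ℕ} (hμ : mu h = n)
    (hlam : lam h = 0) :
    ∃ u : (IwasawaAlgebra p)ˣ, h = PowerSeries.C ((p : ℤ_[p]) ^ n) * (u : IwasawaAlgebra p) := by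
  have hred := red_pfree_ne_zero hh
  obtain ⟨hμ0, hpf⟩ := mu_eq_and_pfree_eq (g := pfree h) (a := 0) hred (by rw [pow_zero, map_one, one_mul])
  have hlam0 : lam (pfree h) = 0 := by
    have : lam (pfree h) = lam h := by simp only [lam, hpf]
    rw [this, hlam]
  obtain ⟨u, hu⟩ := (isUnit_iff_mu_eq_zero_and_lam_eq_zero _).mpr ⟨pfree_ne_zero hh, hμ0, hlam0⟩
  refine ⟨u, ?_⟩
  rw [hu, ← hμ]
  exact eq_C_pow_mu_mul_pfree h

/-- **The algebra of the residual theta transport (general `p`).** In `Λ = ℤ_p⟦T⟧`: if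
`C(pⁿ)·L = g₁·h` (Kato's divisibility up to a power of `p`), `μ(g₁) = 0` (algebraic `μ = 0`), `L` has unit
content (analytic `μ = 0`) and `λ(g₁) = λ(L)` (the λ-TRANSPORT), then for every unit `u ∈ ℤ_p` there is a
generator `g` of `(g₁)` with `ι g = C(u)·ι L` in `ℚ_p⟦T⟧`. Port to general `p` of the kernel of route
`ResidualThetaTransportAtTwo`'s deciding theorem (`closes`, the `hMC` block). [folklore]
[cite: GreenbergVatsal2000, p. 4 (after Thm. (1.2))] -/
theorem exists_generator_of_lamTransport {g₁ L h : IwasawaAlgebra p} {n : ℕ}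
    (hfac : PowerSeries.C ((p : ℤ_[p]) ^ n) * L = g₁ * h)
    (hμ₁ : mu g₁ = 0) (hL : HasUnitContent L) (hlam : lam g₁ = lam L) (u : ℤ_[p]ˣ) :
    ∃ g : IwasawaAlgebra p, Ideal.span ({g} : Set (IwasawaAlgebra p)) = Ideal.span {g₁} ∧
      iwasawaToPowerSeries p g = PowerSeries.C ((u : ℤ_[p]) : ℚ_[p]) * iwasawaToPowerSeries p L := by
  have hL0 : L ≠ 0 := by
    rintro rfl
    exact red_ne_zero_of_hasUnitContent hL (by simp [red])
  have hLHS : PowerSeries.C ((p : ℤ_[p]) ^ n) * L ≠ 0 := mul_ne_zero (C_pow_ne_zero n) hL0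
  have hgh0 : g₁ * h ≠ 0 := hfac ▸ hLHS
  have hg0 : g₁ ≠ 0 := left_ne_zero_of_mul hgh0
  have hh0 : h ≠ 0 := right_ne_zero_of_mul hgh0
  obtain ⟨hμn, hlamn⟩ := mu_lam_C_pow_mul_of_hasUnitContent hL n
  rw [hfac, mu_mul hg0 hh0, hμ₁, zero_add] at hμn
  rw [hfac, lam_mul hg0 hh0, ← hlam] at hlamn
  have hlamh : lam h = 0 := by omega
  obtain ⟨v, hv⟩ := exists_unit_of_mu_of_lam hh0 hμn hlamh
  -- cancel `C(pⁿ)`: `L = g₁ · v`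
  have hLv : L = g₁ * (v : IwasawaAlgebra p) := by
    apply mul_left_cancel₀ (C_pow_ne_zero (p := p) n)
    rw [hfac, hv]; ring
  refine ⟨PowerSeries.C (u : ℤ_[p]) * (g₁ * (v : IwasawaAlgebra p)), ?_, ?_⟩
  · rw [(span_C_units_mul_eq u _).1]
    exact Ideal.span_singleton_mul_right_unit v.isUnit g₁
  · rw [(span_C_units_mul_eq u _).2, ← hLv]

end Algebra

/-! ## §2 Kobayashi's main conjecture at ONE sign from the λ-TRANSPORT (odd `p`, `a_p = 0`, mod-`p` image NOT
onto; print by name) -/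

section Transport

variable (W : WeierstrassCurve ℚ) [W.IsElliptic] [W.IsGloballyMinimal] (p : ℕ) [Fact p.Prime]

/-- `(p : Λ) ^ n = C (p ^ n)`. [folklore] -/
theorem natCast_pow_eq_C_pow (n : ℕ) :
    ((p : IwasawaAlgebra p) ^ n : IwasawaAlgebra p) = PowerSeries.C ((p : ℤ_[p]) ^ n) := by
  rw [map_pow, map_natCast]

/-- **Kobayashi's main conjecture for `(E, p, ε)` from the λ-TRANSPORT at the sign `ε` — odd `p`, good
supersingular with `a_p = 0`, `ρ̄_{E,p}` NOT onto; print BY NAME.** Inputs: Kobayashi 2003 Thm. 1.2 (`h12`: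
`X^ε` f.g. torsion), Thm. 4.1 RATIONAL clause (`h41`: `pⁿ·L^ε_p ∈ char X^ε`, no image hypothesis), the joint /
one-sign Coleman–Kato package (`hCK`, for lane B's `μ`-transfer), the period-unit facts (`h5`/`h3`); per curve: the
one-sign ANALYTIC `μ`-floor `hfloor` («`μ(L^ε_p(E)) = 0`» for the conductor-level newform; at `p = 3` this is the
tree's input-free THEOREM B, §3), and the **λ-TRANSPORT** `hlamT`: for every admissible datum of sign `ε` with
`μ(X^ε) = 0` and every `G ∈ Λ` with `ι G = C(p^m ϖ)·ι L^ε`, `λ(X^ε) = λ(G)` — the NET of route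
`ResidualThetaTransportAtTwo`'s two items Kan⁺ (`ThetaLayerLambdaCongruenceAtTwo`) and Kλ⁺
(`ResidualThetaMainConjectureAtTwo`) at a common layer, read at `p`. Mechanism (= that route's `closes`, ported):
`h41` gives `C(pⁿ)·L = g₁·h` for a generator `g₁` of `char X^ε` (`charIdeal_isPrincipal_holds`); the `μ`-floor and
lane B's brick `SmallImageMuControl.mu_eq_zero_of_isSignedPAdicLFunction_of_hasUnitContent` give `μ(g₁) = 0`; the
period ratio is a `p`-adic unit `u` (`HorocycleMuDoor.periodUnit_of_named_facts`, `X2.varpi_ne_zero_of_isNewformOf`); `hlamT` at `G = C(u)·L`, `m = 0`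
gives `λ(X^ε) = λ(L)`, i.e. `λ(g₁) = λ(L)` (`lam_generator_eq_lambdaInvariant`); §1 finishes. CONDITIONAL on the
displayed hypotheses; closes nothing. [cite: Kobayashi2003, Thm. 1.2 (p. 2), Thm. 4.1 (p. 8), Conjecture (p. 2)]
[cite: GreenbergVatsal2000, p. 4 and §3 Remark 3.4] [cite: PollackWeston2011MT, §3.1] -/
theorem kobayashiMainConjecture_of_lamTransport (hp : p ≠ 2)
    (hCK : thm62_63_73_signedColemanKato_zeta) (h12 : thm12_signedSelmerDual_finite_torsion)
    (h41 : thm41_signedCharIdeal_divisibility)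
    (h5 : realPeriodRat_eq_unit_mul_plusPeriod) (h3 : realPeriodRat_eq_unit_mul_plusPeriod_three)
    (hgood : W.HasGoodReductionAtPrime p) (hap : W.frobeniusTrace p = 0)
    (hns : ¬ W.HasSurjectiveModNGaloisRep p) (ε : ℤˣ)
    (hfloor : ∀ [NeZero (W.conductorNorm ℤ)] (f : CuspForm (Gamma0 (W.conductorNorm ℤ)) 2),
      IsNewformOf W f → ∀ Lplus Lminus : IwasawaAlgebra p, IsPollackPair f p Lplus Lminus →
        HasUnitContent (kobayashiL ε Lplus Lminus))
    (hlamT : ∀ (κ : ZpExtension ℚ p) (γ : absoluteGaloisGroup ℚ),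
      κ.IsCyclotomic → κ.IsTopGenerator γ → IsCyclotomicVariable p γ →
      ∀ [NeZero (W.conductorNorm ℤ)] (f : CuspForm (Gamma0 (W.conductorNorm ℤ)) 2),
        IsNewformOf W f → ∀ (ϖ : ℚ), (ϖ : ℝ) * W.realPeriodRat = plusPeriod f →
      ∀ (Lplus Lminus : IwasawaAlgebra p), IsPollackPair f p Lplus Lminus →
      ∀ (D : SignedSelmerDualData W κ γ ε) [Module.Finite (IwasawaAlgebra p) D.X],
        Module.IsTorsion (IwasawaAlgebra p) D.X → D.mu = 0 →
      ∀ (G : IwasawaAlgebra p) (m : ℕ),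
        iwasawaToPowerSeries p G =
          PowerSeries.C ((p : ℚ_[p]) ^ m * (ϖ : ℚ_[p])) * iwasawaToPowerSeries p (kobayashiL ε Lplus Lminus) →
        lambdaInvariant p D.X = lam G) :
    KobayashiMainConjecture W p ε := by
  intro κ γ hκ hγ hγ' _ f hf ϖ hϖ Lplus Lminus hPP D
  haveI : Module.Finite (IwasawaAlgebra p) D.X := h12.moduleFinite hp hgood hap hκ hγ D
  have hX : Module.IsTorsion (IwasawaAlgebra p) D.X := h12.isTorsion hp hgood hap hκ hγ D
  refine ⟨hX, ?_⟩
  set L := kobayashiL ε Lplus Lminus with hLdef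
  have hLsig : IsSignedPAdicLFunction f p ε L := hPP.isSignedPAdicLFunction_kobayashiL ε
  have hLu : HasUnitContent L := hfloor f hf Lplus Lminus hPP
  -- a generator of `char X^ε`
  obtain ⟨g₁, hchar⟩ := (charIdeal_isPrincipal_holds p D.X).principal
  have hchar' : D.charIdeal = Ideal.span {g₁} := hchar
  -- Kato's divisibility up to `pⁿ` (Kobayashi Thm. 4.1, rational clause)
  obtain ⟨⟨n, hn⟩, -⟩ := h41 W p hp hgood hap f hf κ γ hκ hγ hγ' ε L hLsig D hX
  rw [hchar', Ideal.mem_span_singleton'] at hn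
  obtain ⟨h, hh⟩ := hn
  have hfac : PowerSeries.C ((p : ℤ_[p]) ^ n) * L = g₁ * h := by
    rw [← natCast_pow_eq_C_pow, ← hh, mul_comm h g₁]
  -- algebraic `μ = 0` at the sign `ε` (lane B's brick, modulo print)
  have hμ₁ : mu g₁ = 0 :=
    SmallImageMuControl.mu_eq_zero_of_isSignedPAdicLFunction_of_hasUnitContent W p hCK h12 h5 h3 hp hgood hap
      hns f hf hLsig hLu κ γ hκ hγ hγ' D hchar'
  -- the period ratio is a `p`-adic unit
  have hvϖ : padicValRat p ϖ = 0 :=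
    HorocycleMuDoor.periodUnit_of_named_facts h5 h3 W p hp hgood (hap ▸ dvd_zero _) f hf ϖ hϖ
  obtain ⟨u, hu⟩ := exists_units_coe_eq_ratCast
    (Summit.BirchSwinnertonDyer.Rank1Residual.X2.varpi_ne_zero_of_isNewformOf hf hϖ) hvϖ
  -- the λ-transport at `G = C(u)·L`, `m = 0`
  have hG : iwasawaToPowerSeries p (PowerSeries.C (u : ℤ_[p]) * L) =
      PowerSeries.C ((p : ℚ_[p]) ^ 0 * (ϖ : ℚ_[p])) * iwasawaToPowerSeries p L := by
    rw [(span_C_units_mul_eq u L).2, hu, pow_zero, one_mul]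
  have hμD : D.mu = 0 := by
    have hg0 : g₁ ≠ 0 := by
      intro h0
      apply Literature.NumberTheory.EllipticCurves.Module.charIdeal_ne_bot (IwasawaAlgebra p) D.X
      rw [← SignedSelmerDualData.charIdeal, hchar', h0, Ideal.span_singleton_eq_bot]
    change muInvariant p D.X = 0
    rw [← Summit.BirchSwinnertonDyer.Rank1Residual.X1.MuPart.mu_generator_eq_muInvariant D.X hX hg0 hchar']
    exact hμ₁
  have hlamX := hlamT κ γ hκ hγ hγ' f hf ϖ hϖ Lplus Lminus hPP D hX hμD (PowerSeries.C (u : ℤ_[p]) * L) 0 hG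
  have hL0 : L ≠ 0 := by
    rintro h0
    exact red_ne_zero_of_hasUnitContent hLu (by simp [red, h0])
  have hg0 : g₁ ≠ 0 := by
    intro h0
    apply Literature.NumberTheory.EllipticCurves.Module.charIdeal_ne_bot (IwasawaAlgebra p) D.X
    rw [← SignedSelmerDualData.charIdeal, hchar', h0, Ideal.span_singleton_eq_bot]
  have hlam : lam g₁ = lam L := by
    rw [Summit.BirchSwinnertonDyer.Rank1Residual.X1.ParitySqueeze.lam_generator_eq_lambdaInvariant D.X hX hg0
      hchar', hlamX, lam_mul ((map_ne_zero_iff _ PowerSeries.C_injective).mpr (Units.ne_zero u)) hL0,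
      ((isUnit_iff_mu_eq_zero_and_lam_eq_zero _).mp ((Units.isUnit u).map PowerSeries.C)).2.2, zero_add]
  obtain ⟨g, hspan, hι⟩ := exists_generator_of_lamTransport hfac hμ₁ hLu hlam u
  exact ⟨g, by rw [hchar', hspan], by rw [hι, hu]⟩

end Transport

/-! ## §3 `p = 3`, small image: the analytic floor is THEOREM B (input-free), so the λ-TRANSPORT is ALL that is
left; then the sign is idle (crux L's body) and the registered `p`-inverted λ-shape follows with `m = 0` -/

section Three

variable (W : WeierstrassCurve ℚ) [W.IsElliptic] [W.IsGloballyMinimal] (p : ℕ) [Fact p.Prime]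

/-- **`∃ ε, KobayashiMainConjecture W 3 ε` on crux L's `p = 3` rows from print + the λ-TRANSPORT only.**
Small-image supersingular X7 pair at `p = 3` (`ClassX7 W 3`, `a₃ = 0`, `ρ̄_{E,3}` not onto): the one-sign analytic
`μ`-floor is the tree's INPUT-FREE THEOREM B (`LargeImageMuFloor.signedMuFloor_three`: Vaserstein 1972 + Serre
1972 Prop. 12 + Pollack Prop. 6.18), so §2 applies at its sign `ε₀` as soon as the λ-transport `hlamT` is given at
EVERY sign (only the one at `ε₀` is used; `ε₀` is not known in advance). `¬ W.HasCM` is not needed.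
CONDITIONAL on `hlamT` and print; closes nothing. [cite: Kobayashi2003, Conjecture (p. 2), Thm. 1.2, Thm. 4.1 (p. 8)]
[cite: PollackWeston2011MT, Thm. 4.1 (1), Rem. 4.2, §3.1] [cite: Vaserstein1972SL2, Theorem] -/
theorem exists_kobayashiMainConjecture_three_of_lamTransport (hp3 : p = 3)
    (hCK : thm62_63_73_signedColemanKato_zeta) (h12 : thm12_signedSelmerDual_finite_torsion)
    (h41 : thm41_signedCharIdeal_divisibility)
    (h5 : realPeriodRat_eq_unit_mul_plusPeriod) (h3 : realPeriodRat_eq_unit_mul_plusPeriod_three)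
    (hX : ClassX7 W p) (hap : W.frobeniusTrace p = 0) (hs : ¬ Surj W p)
    (hlamT : ∀ (ε : ℤˣ) (κ : ZpExtension ℚ p) (γ : absoluteGaloisGroup ℚ),
      κ.IsCyclotomic → κ.IsTopGenerator γ → IsCyclotomicVariable p γ →
      ∀ [NeZero (W.conductorNorm ℤ)] (f : CuspForm (Gamma0 (W.conductorNorm ℤ)) 2),
        IsNewformOf W f → ∀ (ϖ : ℚ), (ϖ : ℝ) * W.realPeriodRat = plusPeriod f →
      ∀ (Lplus Lminus : IwasawaAlgebra p), IsPollackPair f p Lplus Lminus →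
        HasUnitContent (kobayashiL ε Lplus Lminus) →
      ∀ (D : SignedSelmerDualData W κ γ ε) [Module.Finite (IwasawaAlgebra p) D.X],
        Module.IsTorsion (IwasawaAlgebra p) D.X → D.mu = 0 →
      ∀ (G : IwasawaAlgebra p) (m : ℕ),
        iwasawaToPowerSeries p G =
          PowerSeries.C ((p : ℚ_[p]) ^ m * (ϖ : ℚ_[p])) * iwasawaToPowerSeries p (kobayashiL ε Lplus Lminus) →
        lambdaInvariant p D.X = lam G) :
    ∃ ε : ℤˣ, KobayashiMainConjecture W p ε := by
  obtain ⟨ε₀, hε₀⟩ := LargeImageMuFloor.signedMuFloor_three (W := W) p hp3 hX.1.1 hap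
  refine ⟨ε₀, kobayashiMainConjecture_of_lamTransport W p (by omega) hCK h12 h41 h5 h3 hX.1.1 hap
    hs ε₀ (fun f hf Lplus Lminus hPP ↦ hε₀ f hf Lplus Lminus hPP) ?_⟩
  intro κ γ hκ hγ hγ' _ f hf ϖ hϖ Lplus Lminus hPP D _ hXt hμ G m hG
  exact hlamT ε₀ κ γ hκ hγ hγ' f hf ϖ hϖ Lplus Lminus hPP (hε₀ f hf Lplus Lminus hPP) D hXt hμ G m hG

/-- **Crux L's signature body at a `p = 3` small-image pair from print + the λ-TRANSPORT**: with the JOINT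
Coleman–Kato package by name (`hJ`, Kobayashi Thm. 5.2 iv) / 6.2–6.3 / 7.3 i)) the sign of the Eisenstein half is
idle on class X7 (slh-p1's `SignDefect.X7.exists_kobayashiLowerDivisibility_iff_forall`), so the one-sign main
conjecture of `exists_kobayashiMainConjecture_three_of_lamTransport` yields `∀ ε, KobayashiLowerDivisibility W 3 ε`.
CONDITIONAL on `hlamT` and print; closes nothing. [cite: Kobayashi2003, Thm. 5.2 iv) (p. 9), Thm. 7.4 (p. 13), Conjecture (p. 2)] -/
theorem forall_kobayashiLowerDivisibility_three_of_lamTransport (hp3 : p = 3)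
    (hJ : thm62_63_73_signedColemanKato_zetaJoint) (h12 : thm12_signedSelmerDual_finite_torsion)
    (h41 : thm41_signedCharIdeal_divisibility)
    (h5 : realPeriodRat_eq_unit_mul_plusPeriod) (h3 : realPeriodRat_eq_unit_mul_plusPeriod_three)
    (hX : ClassX7 W p) (hap : W.frobeniusTrace p = 0) (hs : ¬ Surj W p)
    (hlamT : ∀ (ε : ℤˣ) (κ : ZpExtension ℚ p) (γ : absoluteGaloisGroup ℚ),
      κ.IsCyclotomic → κ.IsTopGenerator γ → IsCyclotomicVariable p γ →
      ∀ [NeZero (W.conductorNorm ℤ)] (f : CuspForm (Gamma0 (W.conductorNorm ℤ)) 2),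
        IsNewformOf W f → ∀ (ϖ : ℚ), (ϖ : ℝ) * W.realPeriodRat = plusPeriod f →
      ∀ (Lplus Lminus : IwasawaAlgebra p), IsPollackPair f p Lplus Lminus →
        HasUnitContent (kobayashiL ε Lplus Lminus) →
      ∀ (D : SignedSelmerDualData W κ γ ε) [Module.Finite (IwasawaAlgebra p) D.X],
        Module.IsTorsion (IwasawaAlgebra p) D.X → D.mu = 0 →
      ∀ (G : IwasawaAlgebra p) (m : ℕ),
        iwasawaToPowerSeries p G =
          PowerSeries.C ((p : ℚ_[p]) ^ m * (ϖ : ℚ_[p])) * iwasawaToPowerSeries p (kobayashiL ε Lplus Lminus) →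
        lambdaInvariant p D.X = lam G) :
    ∀ ε : ℤˣ, KobayashiLowerDivisibility W p ε := by
  have hp : p ≠ 2 := by omega
  have hMC := exists_kobayashiMainConjecture_three_of_lamTransport W p hp3
    (thm62_63_73_signedColemanKato_zeta_of_joint hJ) h12 h41 h5 h3 hX hap hs hlamT
  obtain ⟨ε₀, hε₀⟩ := hMC
  exact (SignDefect.X7.exists_kobayashiLowerDivisibility_iff_forall W p h12 h5 h3 hJ hp hX hap).mp
    ⟨ε₀, kobayashiLowerDivisibility_of_mainConjecture hε₀⟩

/-- **The registered stub's text (`stub_lambdaLowerThree_ns` = retired 23118 `SmallImageLambdaLowerAtThree`, per pair)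
from print + the λ-TRANSPORT**: the `p`-inverted Eisenstein half at every sign and datum, with `m = 0`, read off
`forall_kobayashiLowerDivisibility_three_of_lamTransport`. CONDITIONAL; closes nothing.
[cite: Kobayashi2003, Conjecture (p. 2), Thm. 4.1 (p. 8)] -/
theorem lambdaShape_three_of_lamTransport (hp3 : p = 3)
    (hJ : thm62_63_73_signedColemanKato_zetaJoint) (h12 : thm12_signedSelmerDual_finite_torsion)
    (h41 : thm41_signedCharIdeal_divisibility)
    (h5 : realPeriodRat_eq_unit_mul_plusPeriod) (h3 : realPeriodRat_eq_unit_mul_plusPeriod_three)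
    (hX : ClassX7 W p) (hap : W.frobeniusTrace p = 0) (hs : ¬ Surj W p)
    (hlamT : ∀ (ε : ℤˣ) (κ : ZpExtension ℚ p) (γ : absoluteGaloisGroup ℚ),
      κ.IsCyclotomic → κ.IsTopGenerator γ → IsCyclotomicVariable p γ →
      ∀ [NeZero (W.conductorNorm ℤ)] (f : CuspForm (Gamma0 (W.conductorNorm ℤ)) 2),
        IsNewformOf W f → ∀ (ϖ : ℚ), (ϖ : ℝ) * W.realPeriodRat = plusPeriod f →
      ∀ (Lplus Lminus : IwasawaAlgebra p), IsPollackPair f p Lplus Lminus →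
        HasUnitContent (kobayashiL ε Lplus Lminus) →
      ∀ (D : SignedSelmerDualData W κ γ ε) [Module.Finite (IwasawaAlgebra p) D.X],
        Module.IsTorsion (IwasawaAlgebra p) D.X → D.mu = 0 →
      ∀ (G : IwasawaAlgebra p) (m : ℕ),
        iwasawaToPowerSeries p G =
          PowerSeries.C ((p : ℚ_[p]) ^ m * (ϖ : ℚ_[p])) * iwasawaToPowerSeries p (kobayashiL ε Lplus Lminus) →
        lambdaInvariant p D.X = lam G)
    (ε : ℤˣ) (κ : ZpExtension ℚ p) (γ : absoluteGaloisGroup ℚ) (hκ : κ.IsCyclotomic)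
    (hγ : κ.IsTopGenerator γ) (hγ' : IsCyclotomicVariable p γ)
    [NeZero (W.conductorNorm ℤ)] (f : CuspForm (Gamma0 (W.conductorNorm ℤ)) 2) (hf : IsNewformOf W f)
    (ϖ : ℚ) (hϖ : (ϖ : ℝ) * W.realPeriodRat = plusPeriod f)
    (Lplus Lminus : IwasawaAlgebra p) (hPP : IsPollackPair f p Lplus Lminus)
    (D : SignedSelmerDualData W κ γ ε) :
    ∃ (g h : IwasawaAlgebra p) (m : ℕ), D.charIdeal = Ideal.span {g} ∧
      iwasawaToPowerSeries p (PowerSeries.C ((p : ℤ_[p]) ^ m) * g) =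
        PowerSeries.C (ϖ : ℚ_[p]) * iwasawaToPowerSeries p (kobayashiL ε Lplus Lminus * h) := by
  obtain ⟨g, h, hg, hι⟩ := forall_kobayashiLowerDivisibility_three_of_lamTransport W p hp3 hJ h12 h41 h5 h3 hX
    hap hs hlamT ε κ γ hκ hγ hγ' f hf ϖ hϖ Lplus Lminus hPP D
  exact ⟨g, h, 0, hg, by rw [pow_zero, map_one, one_mul, hι]⟩

end Three

end Summit.BirchSwinnertonDyer.BirchSwinnertonDyer.Theorems.SmallImageLambdaLowerThreeNsThetaTransport

end
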